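import Literature.Claims.NS.Polihronov2025
import Summits.NavierStokesRegularity.NavierStokesRegularity.Theorems.SoloSalvageLin2013Maximal
import Literature.Analysis.FluidPDE.NSVorticityBKMLocalExistence
import Literature.Analysis.FluidPDE.TaoLocalisation
import HarnessLib

/-!
# Solo salvage for claim C36 `Polihronov2025` (cell `ns-claims`, D-0090): the local existence step
# (Step 2, bullet 2 p.5) is TRUE — kernel discharge

Claim skeleton: `Literature/Claims/NS/Polihronov2025.lean` (typist `ns-claims-typist-1` g2;
J. Polihronov, arXiv:2504.21000 v4). Kill of record (refuter-4): `…Theorems.Polihronov2025.not_UniformBoundsAbs`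
(Step 4, bullet 3 p.5), whose file also discharges Steps 1 and 3 (`lemma12_holds`, `lemma11_holds`).
This file (seat `ns-claims-salvage-p3`) kernel-discharges the remaining TRUE classical step before the
locator:

* `polihronov2025_localExistence_holds : LocalExistence` — bullet 2 «Existence and uniqueness» p.5 /
  (A.6)–(A.7) p.7 / (B.5)–(B.6) pp.9–10 («It is well known that … one can always construct an unique,
  infinitely differentiable … NSE solution … in the time interval [0,τ)»): (i) Schwartz setting — a
  classical finite-energy solution on some `[0,τ)` from every smooth divergence-free rapidly decaying
  datum: Majda–Bertozzi 2002 Thm 3.4 (Kato 1972) = tree `MajdaBertozzi2002_localExistenceH3_holds`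
  (the `H^∞` hypotheses from the decay, `HasRapidSpatialDecay.lintegral_enorm_iteratedFDeriv_sq_lt_top`;
  the energy clause from the order-0 Sobolev bound of the class); (ii) periodic setting — a classical
  lattice-periodic solution on some `[0,τ)`: the periodic local theory with the maximal alternative
  already kernel-proved for C21 (`…Theorems.Lin2013Salvage.lin2013_step1_holds`, via
  `Torus.exists_maximal_classicalNS`, Robinson–Rodrigo–Sadowski 2016 §6.3/§8.1), either branch of
  which yields a local solution.

Solo lane (`Theorems/SoloSalvage<Slug>.lean`, no item).

WHAT THIS IS NOT: not a claim about NS regularity or blow-up; not a claim about any author beyond the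
typed locator.
-/

noncomputable section

-- The summit-side namespace repeats the summit name by design (D-0017 layout); tree precedent
-- `SoloSalvageLam2019.lean`.
set_option linter.dupNamespace false

open MeasureTheory Set
open scoped ENNReal NNReal ContDiff

namespace Summit.NavierStokesRegularity.NavierStokesRegularity.Theorems.Polihronov2025Salvage

open Literature.Analysis.FluidPDE Literature.Claims.NS.Polihronov2025
open Summit.NavierStokesRegularity.NavierStokesRegularity.Theorems.Lin2013Salvage

/-- **Step 2 — local existence (bullet 2 p.5; (A.6)–(A.7), (B.5)–(B.6)) holds**: Schwartz-class data
issue local classical finite-energy solutions (Majda–Bertozzi Thm 3.4 in the tree), and smooth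
divergence-free lattice-periodic data issue local classical periodic solutions (the periodic maximal
theory, `lin2013_step1_holds`). -/
theorem polihronov2025_localExistence_holds : Literature.Claims.NS.Polihronov2025.LocalExistence := by
  intro ν hν
  refine ⟨fun u₀ hu₀ => ?_, fun u₀ hu₀ => ?_⟩
  · -- Schwartz setting
    obtain ⟨hsmooth, hdiv, hdec⟩ := hu₀
    have hsob : ∀ n : ℕ, ∫⁻ x, ‖iteratedFDeriv ℝ n u₀ x‖ₑ ^ 2 < ⊤ := fun n =>
      hdec.lintegral_enorm_iteratedFDeriv_sq_lt_top n
    set Atot : ℝ≥0∞ := ∑ n ∈ Finset.range 4, ∫⁻ x, ‖iteratedFDeriv ℝ n u₀ x‖ₑ ^ 2 with hA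
    have hAtop : Atot ≠ ⊤ := by
      rw [hA]
      exact (ENNReal.sum_lt_top.2 fun n _ => hsob n).ne
    obtain ⟨τ, hτ, hloc⟩ := MajdaBertozzi2002_localExistenceH3_holds hν.le Atot.toNNReal
    obtain ⟨v, q, hv, hv0, hB⟩ :=
      hloc hsmooth (fun x => hdiv x) hsob (by rw [ENNReal.coe_toNNReal hAtop])
    obtain ⟨C, hC⟩ := hB 0
    refine ⟨τ, hτ, v, q, ⟨hv.mono Ico_subset_Icc_self (uniqueDiffOn_Ico 0 τ), ?_, ?_⟩, hv0⟩
    · rw [hv0]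
      exact hdec
    · refine ⟨C, ENNReal.coe_lt_top, fun t ht => ?_⟩
      have h := hC t (Ico_subset_Icc_self ht)
      have hfun : ∀ x, ‖iteratedFDeriv ℝ 0 (v t) x‖ₑ = ‖v t x‖ₑ := fun x => by
        rw [← ofReal_norm, norm_iteratedFDeriv_zero, ofReal_norm]
      simp_rw [hfun] at h
      exact h
  · -- periodic setting
    obtain ⟨hsmooth, hdiv, hper⟩ := hu₀
    rcases lin2013_step1_holds ν hν u₀ hsmooth hdiv hper with ⟨u, p, hsol, hu0⟩ | ⟨T, hT, u, p, hsol, hu0, -⟩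
    · refine ⟨1, one_pos, u, p, ⟨hsol.1.mono Ico_subset_Ici_self (uniqueDiffOn_Ico 0 1),
        fun t ht => (hsol.2 t (Ico_subset_Ici_self ht)).1,
        fun t ht => (hsol.2 t (Ico_subset_Ici_self ht)).2⟩, hu0⟩
    · exact ⟨T, hT, u, p, ⟨hsol.1, fun t ht => (hsol.2 t ht).1, fun t ht => (hsol.2 t ht).2⟩, hu0⟩

end Summit.NavierStokesRegularity.NavierStokesRegularity.Theorems.Polihronov2025Salvage

end
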